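import Summits.KontsevichZagierPeriods.KontsevichZagierPeriods.Theorems.FermatIsogenyBetaLinearSectorStubSectorPathsAux
import Summits.KontsevichZagierPeriods.KontsevichZagierPeriods.Theorems.FermatIsogenyBetaLinearSectorStubTransportInvX
import Summits.KontsevichZagierPeriods.KontsevichZagierPeriods.Theorems.FermatIsogenyBetaLinearSectorStubSwapRel
import Summits.KontsevichZagierPeriods.KontsevichZagierPeriods.Theorems.FermatIsogenyBetaLinearSectorStubFermatSymbolData
import Literature.NumberTheory.Transcendental.CurvePeriodsGmLoopsProofs
import Literature.NumberTheory.Transcendental.CurvePeriodsProofs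
import Mathlib.Tactic.Module
import HarnessLib

/-!
# `BetaLinearSector` (stmt-KontsevichZagierPeriods-3897) — section `Sector`: helpers for the upper sector relation

Small helpers for the lead's assembly of the UPPER SECTOR RELATION of line `fermat-sector-transport`, section `Sector`
(the Fermat reflection class of the crux at all levels): the unit identity `ε̄^s ε̄^t = −ε^r` (`r + s + t = N`, `ε = e^{iπ/N}`), the swapped path `(y, x)` of a path on the Fermat curve, and the
(R4)-transport along `g₂ ∘ swap = (x,y) ↦ (1/y, εx/y)` derived from the landed `stub_swapRel` and `stub_transportInvX`.

References: B. Gross (appendix by D. Rohrlich), Invent. Math. 45 (1978), §1; A. Huber, G. Wüstholz, *Transcendence and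
linear relations of 1-periods* (2022), §13.1.
-/

noncomputable section

namespace Summit.KontsevichZagierPeriods.FermatIsogeny.BetaLinearSector

open scoped BigOperators
open MeasureTheory Set MvPolynomial
open Literature.NumberTheory.Transcendental Literature.NumberTheory.Transcendental.CurvePeriods

/-- The unit identity `ε̄^s · ε̄^t = −ε^r` for `r + s + t = N` (`ε = e^{iπ/N}`, `ε̄^N = −1`, `ε ε̄ = 1`). [folklore] -/
theorem upperSector_epsBar_pow_mul {N r s t : ℕ} (hr : 1 ≤ r) (h : r + s + t = N) :
    Complex.exp (-(↑Real.pi * Complex.I / (N : ℂ))) ^ s * Complex.exp (-(↑Real.pi * Complex.I / (N : ℂ))) ^ t =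
      -(Complex.exp (↑Real.pi * Complex.I / (N : ℂ)) ^ r) := by
  have hN : N ≠ 0 := by omega
  have hprod : Complex.exp (↑Real.pi * Complex.I / (N : ℂ)) ^ r *
      Complex.exp (-(↑Real.pi * Complex.I / (N : ℂ))) ^ r = 1 := by
    rw [← mul_pow, sectorChart_eps_mul_epsBar, one_pow]
  have hall : Complex.exp (-(↑Real.pi * Complex.I / (N : ℂ))) ^ s *
      Complex.exp (-(↑Real.pi * Complex.I / (N : ℂ))) ^ t *
      Complex.exp (-(↑Real.pi * Complex.I / (N : ℂ))) ^ r = -1 := by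
    rw [← pow_add, ← pow_add, show s + t + r = N by omega, sectorChart_epsBar_pow hN]
  have hε : Complex.exp (-(↑Real.pi * Complex.I / (N : ℂ))) ^ r ≠ 0 := pow_ne_zero _ (Complex.exp_ne_zero _)
  have key : (Complex.exp (-(↑Real.pi * Complex.I / (N : ℂ))) ^ s *
      Complex.exp (-(↑Real.pi * Complex.I / (N : ℂ))) ^ t +
      Complex.exp (↑Real.pi * Complex.I / (N : ℂ)) ^ r) *
      Complex.exp (-(↑Real.pi * Complex.I / (N : ℂ))) ^ r = 0 := by
    rw [add_mul, hall, hprod]; ring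
  rcases mul_eq_zero.1 key with h0 | h0
  · exact eq_neg_of_add_eq_zero_left h0
  · exact absurd h0 hε

/-- The swapped path `(y, x)` of a `C¹` path `(x, y)` on the affine Fermat curve exists as a `C¹` path with algebraic
end points (the curve is symmetric). [folklore] -/
theorem upperSector_exists_swapPath {N : ℕ} (δ : CurvePath (⟨2, 1, ![X 0 ^ N + X 1 ^ N - 1]⟩ : CurveData)) :
    ∃ δs : CurvePath (⟨2, 1, ![X 0 ^ N + X 1 ^ N - 1]⟩ : CurveData), ∀ t : ℝ, δs.toFun t = ![δ.toFun t 1, δ.toFun t 0] :=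
  ⟨{ toFun := fun t => ![δ.toFun t 1, δ.toFun t 0]
     contDiffOn := by
       refine contDiffOn_pi.2 fun i => ?_
       fin_cases i
       · exact δ.contDiffOn_apply 1
       · exact δ.contDiffOn_apply 0
     mem_points := fun t ht => by
       have h := fermatSwap_mem_points N (δ.toFun t) (δ.mem_points t ht)
       convert h using 1
       funext l
       fin_cases l <;> simp
     algebraic_zero := fun i => by
       fin_cases i
       · simpa using δ.algebraic_zero 1
       · simpa using δ.algebraic_zero 0
     algebraic_one := fun i => by
       fin_cases i
       · simpa using δ.algebraic_one 1
       · simpa using δ.algebraic_one 0 }, fun _ => rfl⟩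

/-- **Transport along `g₂ ∘ swap : (x,y) ↦ (1/y, εx/y)`** (derived from the landed `stub_swapRel` and
`stub_transportInvX`): for positive `i, j, k` with `i + j + k = N` and a path `δ` on `F_N` avoiding `y = 0` on `[0,1]`, with
`δ″(t) = (1/δ_y, ε δ_x/δ_y)`: `(F_N, ω_{i,j}, δ) + ε̄^i (F_N, ω_{k,i}, δ″) ∼ 0` (the swap gives `(ω_{i,j}, δ) ∼ −(ω_{j,i}, swap∘δ)`,
the transport along `g₂` gives `(ω_{j,i}, swap∘δ) ∼ ε̄^i (ω_{k,i}, g₂∘swap∘δ)`). [cite: HuberWustholz2022, §13.1 (B) (p. 120)] -/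
theorem upperSector_transportInvYX : ∀ (N i j k : ℕ), 1 ≤ i → 1 ≤ j → 1 ≤ k → i + j + k = N →
    ∀ (hZ : (⟨2, 1, ![X 0 ^ N + X 1 ^ N - 1]⟩ : CurveData).IsSmoothAffineCurve)
      (hω : ∀ l, HasAlgCoeffs ((![X 0 ^ (i - 1) * X 1 ^ j, -(X 0 ^ i * X 1 ^ (j - 1))] :
        Fin 2 → MvPolynomial (Fin 2) ℂ) l))
      (hω' : ∀ l, HasAlgCoeffs ((![X 0 ^ (k - 1) * X 1 ^ i, -(X 0 ^ k * X 1 ^ (i - 1))] :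
        Fin 2 → MvPolynomial (Fin 2) ℂ) l))
      (δ δ' : CurvePath (⟨2, 1, ![X 0 ^ N + X 1 ^ N - 1]⟩ : CurveData)),
    (∀ t ∈ Set.Icc (0:ℝ) 1, δ.toFun t 1 ≠ 0) →
    (∀ t ∈ Set.Icc (0:ℝ) 1, δ'.toFun t =
      ![(δ.toFun t 1)⁻¹, Complex.exp (↑Real.pi * Complex.I / (N : ℂ)) * δ.toFun t 0 / δ.toFun t 1]) →
    ∃ (k' : ℕ) (ρ : Fin k' → (PeriodSymbol →₀ ℂ)) (a : Fin k' → ℂ),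
      (∀ l, IsElementaryRelation (ρ l)) ∧ (∀ l, IsAlgebraic ℚ (a l)) ∧
      (Finsupp.single (⟨(⟨2, 1, ![X 0 ^ N + X 1 ^ N - 1]⟩ : CurveData), hZ,
            (![X 0 ^ (i - 1) * X 1 ^ j, -(X 0 ^ i * X 1 ^ (j - 1))] : Fin 2 → MvPolynomial (Fin 2) ℂ), hω, δ⟩ :
            PeriodSymbol) (1 : ℂ) +
          (Complex.exp (-(↑Real.pi * Complex.I / (N : ℂ)))) ^ i •
            Finsupp.single (⟨(⟨2, 1, ![X 0 ^ N + X 1 ^ N - 1]⟩ : CurveData), hZ,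
              (![X 0 ^ (k - 1) * X 1 ^ i, -(X 0 ^ k * X 1 ^ (i - 1))] :
                Fin 2 → MvPolynomial (Fin 2) ℂ), hω', δ'⟩ : PeriodSymbol) (1 : ℂ)) =
        ∑ l, a l • ρ l := by
  intro N i j k hi hj hk hN hZ hω hω' δ δ' hδ hδ'
  have hωs : ∀ l, HasAlgCoeffs ((![X 0 ^ (j - 1) * X 1 ^ i, -(X 0 ^ j * X 1 ^ (i - 1))] :
      Fin 2 → MvPolynomial (Fin 2) ℂ) l) := by
    intro l
    fin_cases l
    · exact ((hasAlgCoeffs_X 0).pow (j - 1)).mul ((hasAlgCoeffs_X 1).pow i)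
    · exact (((hasAlgCoeffs_X 0).pow j).mul ((hasAlgCoeffs_X 1).pow (i - 1))).neg
  obtain ⟨δs, hδs⟩ := upperSector_exists_swapPath δ
  -- the swap: `(ω_{i,j}, δ) + (ω_{j,i}, swap δ) ∼ 0`
  have hsw := stub_swapRel N i j hi hj hZ hω hωs δ δs (fun t _ => hδs t)
  -- the transport along `g₂` of the swapped path: `(ω_{j,i}, swap δ) − ε̄^i (ω_{k,i}, g₂ ∘ swap ∘ δ) ∼ 0`
  have htr := stub_transportInvX N j i k hj hi hk (by omega) hZ hωs hω' δs δ'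
    (fun t ht => by rw [hδs t]; simpa using hδ t ht) (fun t ht => by rw [hδ' t ht, hδs t]; simp)
  obtain ⟨k', ρ, a, hρ, ha, he⟩ := span_sub hsw htr
  exact ⟨k', ρ, a, hρ, ha, by rw [← he]; module⟩

end Summit.KontsevichZagierPeriods.FermatIsogeny.BetaLinearSector

end
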